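/-
Copyright: the b2b-balaban T⁴-continuum CRUX team, row NE7b OWNER lineage `t4-ne7b-p1` (gen 134). Project licence.
-/
import Summits.QuantumFields.BalabanUV.T4Continuum.Spine.NE7b.SupBlockingWeightRegeneration

/-!
# BLOCKING REGENERATES THE WEIGHT OF THE LARGE SETS — THE HONEST FORM OF (359)'S SEPARATION: for cubes of side `L` in `d ≥ 1` dimensions a connected
# cell set can meet `2` (in `d = 1`) or `2^d` blocks with as many cells (at a face ∕ corner), so (359)'s separation `ℓ(#B(Y) − 1) + 1 ≤ #Y` forces
# `ℓ ≤ 1` there.  What DOES hold for cubes is the LARGE-SET separation with a threshold `m` (`m = 3^d`, `ℓ = ⌊L∕3^d⌋`: among `k` blocks met, `⌈k∕3^d⌉`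
# are pairwise non-adjacent, and joining non-adjacent blocks costs `≥ L` cells each):
#   `ℓ·(#B(Y) − m) + 1 ≤ #Y`   for every `R`-connected `Y`   (truncated subtraction: vacuous for `#B(Y) ≤ m`).
# Under it, re-indexing the support terms by block supports as in (359) gives, for every block `p'`,
#   `Σ_{Y' ∋ p'}‖K'(Y')‖e^{τℓ(#Y' − m)} ≤ Σ_{q∈blk p'}Σ_{Y∋q}‖K(Y)‖e^{τ(#Y−1)} ≤ b·e^{−τ}·η`,
# so the LARGE block supports (`#Y' ≥ m + 1`, where `#Y' − m ≥ #Y'∕(m+1)`) carry weight `τℓ∕(m+1)` PER BLOCK — regenerated as soon as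
# `ℓ ≥ (m+1)(1+τ')∕τ` — while the SMALL SETS (`#Y' ≤ m`; for cubes: the block supports inside a `3^d`-cluster) gain nothing: they are the local ∕
# small-set part that relevant–irrelevant analysis and renormalisation conditions must handle (NC-NE7b-α's blocking question, combinatorial half,
# large-set form; row NE7b, node U5c; (359) BY NAME; [folklore])

Cell `pub-balaban`, sub-cell `t4`, spine estimate NE7b (`T4WeightBudget.RelWeightBound`; the cell's OWN estimate — NOT PRINTED in
[Bałaban 1983–89], NOT PROVED).  Crux-route work under `Spine/NE7b/` by the row OWNER (`t4-ne7b-p1` gen 134, file (360)) under FREEZE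
(0)'s crux-prover clause, on `g134/records/SCOPING-d6-iteration.md` (L2)∕DECISION (4) (correcting the scope of (359): its `m = 1` separation is
satisfiable with large `ℓ` only for block maps without faces ∕ corners); NOTHING of Bałaban's is named as a Lean object, valued or asserted; no
`T4Continuum/Support` leaf typed; no `def`, no notation; zero `sorry`.  Imports (BY NAME): the OWNER's (359) `…SupBlockingWeightRegeneration`
(`sum_blocked_eq`, `isRConnected_image` are reused as they stand); Mathlib's `Finset.sum_fiberwise_eq_sum_filter`.

WHAT IS PROVED ([folklore]; `B : V → W`, `blk : W → Finset V` with `q ∈ blk (B q)`, `K : Finset V → ℂ`, `T` a finite family, threshold `m : ℕ`):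
* §1 `exp_blockWeight_le_largeSet` (`ℓ(#B(Y) − m) + 1 ≤ #Y ⟹ e^{τℓ(#B(Y)−m)} ≤ e^{τ(#Y−1)}`), THE END **`blockedNorm_le_cellNorm_largeSet`**
  (`Σ_{Y'∈B(T), p'∈Y'}‖K'(Y')‖e^{τℓ(#Y'−m)} ≤ Σ_{q∈blk p'}Σ_{Y∈T, q∈Y}‖K(Y)‖e^{τ(#Y−1)}`), **`blockedNorm_le_of_uniform_largeSet`** (`≤ b·e^{−τ}·η`);
* §2 **`largeSetNorm_le`** (`Σ_{Y'∈B(T), p'∈Y', m+1 ≤ #Y'}‖K'(Y')‖e^{(τℓ∕(m+1))#Y'} ≤ b·e^{−τ}·η` — weight `τℓ∕(m+1)` PER BLOCK on the large sets); §3 toy.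

HONEST (what this is NOT).  Combinatorics of supports; the separation with threshold is a HYPOTHESIS (its verification for cubes in `ℤ^d` ∕ the torus —
`m = 3^d`, `ℓ = ⌊L∕3^d⌋` — is elementary lattice geometry, not typed here); small sets are NOT improved (the renormalisation ∕ relevant-part problem,
NC-NE7b-α UNRULED); no field rescaling; scalar skeleton ((A3)); nothing of Bałaban's asserted.  BY-NAME EFFECT ON THE WALL: NONE.  NE7b NOT PRINTED ∕
NOT PROVED; spine PROVED 0∕9; rung (B)+1 — the programme's measures remain FINITE-torus statements; NOT the mass gap, NOT Clay.  HONEST DEPENDENCY: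
continuum YM on T⁴ ⇐ BetaPertH ∧ nine spine estimates (0∕9 proved); BetaPertH ⇐ (D1) ∧ (D4) ∧ CAP+tail; G-an2-4 gates asym, D1 and NE2∕3∕4.
-/

set_option autoImplicit false

noncomputable section

namespace Summit.QuantumFields.BalabanUV.T4Continuum.NE7b.SupBlockingLargeSets

open Finset Real
open scoped BigOperators
open Literature.Probability.LatticeModels

variable {V W : Type*} [DecidableEq V] [DecidableEq W] {K : Finset V → ℂ} {τ η : ℝ} {ℓ b m : ℕ}

/-! ## §1. The regenerated norm with a small-set threshold -/

omit [DecidableEq V] in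
/-- **Large-set separation converts cell weight into block weight**: `0 ≤ τ`, `ℓ(#B(Y) − m) + 1 ≤ #Y` ⟹ `e^{τℓ(#B(Y) − m)} ≤ e^{τ(#Y − 1)}`. [folklore] -/
theorem exp_blockWeight_le_largeSet (hτ : 0 ≤ τ) (B : V → W) {Y : Finset V} (hsep : ℓ * ((Y.image B).card - m) + 1 ≤ Y.card) :
    Real.exp (τ * ((ℓ * ((Y.image B).card - m) : ℕ) : ℝ)) ≤ Real.exp (τ * (((Y.card - 1 : ℕ)) : ℝ)) := by
  refine exp_le_exp.2 (mul_le_mul_of_nonneg_left ?_ hτ)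
  have h : ℓ * ((Y.image B).card - m) ≤ Y.card - 1 := by omega
  exact_mod_cast h

/-- **THE END — THE BLOCKED NORM IS CONTROLLED BY THE CELL NORM, WITH WEIGHT `τℓ` PER BLOCK BEYOND THE THRESHOLD `m`.**  `0 ≤ τ`; every cell lies in the cell list of its
block (`q ∈ blk (B q)`); large-set separation on the polymers of `T` (`ℓ(#B(Y) − m) + 1 ≤ #Y` for `Y ∈ T`) ⟹ for every block `p'`,
`Σ_{Y'∈B(T), p'∈Y'}‖K'(Y')‖e^{τℓ(#Y'−m)} ≤ Σ_{q∈blk p'}Σ_{Y∈T, q∈Y}‖K(Y)‖e^{τ(#Y−1)}`. [folklore] -/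
theorem blockedNorm_le_cellNorm_largeSet (hτ : 0 ≤ τ) (B : V → W) (blk : W → Finset V) (hblk : ∀ q, q ∈ blk (B q)) (T : Finset (Finset V))
    (hsep : ∀ Y ∈ T, ℓ * ((Y.image B).card - m) + 1 ≤ Y.card) (p' : W) :
    ∑ Y' ∈ T.image (fun Y => Y.image B) with p' ∈ Y',
        ‖∑ Y ∈ T with Y.image B = Y', K Y‖ * Real.exp (τ * ((ℓ * (Y'.card - m) : ℕ) : ℝ)) ≤
      ∑ q ∈ blk p', ∑ Y ∈ T with q ∈ Y, ‖K Y‖ * Real.exp (τ * ((Y.card - 1 : ℕ) : ℝ)) := by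
  classical
  set g : Finset V → ℝ := fun Y => ‖K Y‖ * Real.exp (τ * ((Y.card - 1 : ℕ) : ℝ)) with hg
  have hg0 : ∀ Y, 0 ≤ g Y := fun Y => by positivity
  calc ∑ Y' ∈ T.image (fun Y => Y.image B) with p' ∈ Y', ‖∑ Y ∈ T with Y.image B = Y', K Y‖ * Real.exp (τ * ((ℓ * (Y'.card - m) : ℕ) : ℝ))
      ≤ ∑ Y' ∈ T.image (fun Y => Y.image B) with p' ∈ Y', ∑ Y ∈ T with Y.image B = Y', g Y := by
        refine sum_le_sum fun Y' _ => ?_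
        calc ‖∑ Y ∈ T with Y.image B = Y', K Y‖ * Real.exp (τ * ((ℓ * (Y'.card - m) : ℕ) : ℝ))
            ≤ (∑ Y ∈ T with Y.image B = Y', ‖K Y‖) * Real.exp (τ * ((ℓ * (Y'.card - m) : ℕ) : ℝ)) :=
              mul_le_mul_of_nonneg_right (norm_sum_le _ _) (exp_pos _).le
          _ = ∑ Y ∈ T with Y.image B = Y', ‖K Y‖ * Real.exp (τ * ((ℓ * (Y'.card - m) : ℕ) : ℝ)) := sum_mul _ _ _
          _ ≤ ∑ Y ∈ T with Y.image B = Y', g Y := by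
              refine sum_le_sum fun Y hY => mul_le_mul_of_nonneg_left ?_ (norm_nonneg _)
              obtain ⟨hYT, hU⟩ := mem_filter.1 hY
              rw [← hU]
              exact exp_blockWeight_le_largeSet hτ B (hsep Y hYT)
    _ = ∑ Y ∈ T with Y.image B ∈ (T.image (fun Y => Y.image B)).filter (fun Y' => p' ∈ Y'), g Y := sum_fiberwise_eq_sum_filter _ _ _ _
    _ ≤ ∑ Y ∈ T with ∃ q ∈ blk p', q ∈ Y, g Y := by
        refine sum_le_sum_of_subset_of_nonneg (fun Y hY => ?_) fun _ _ _ => hg0 _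
        obtain ⟨hYT, hY'⟩ := mem_filter.1 hY
        obtain ⟨q, hqY, hq⟩ := mem_image.1 (mem_filter.1 hY').2
        exact mem_filter.2 ⟨hYT, q, hq ▸ hblk q, hqY⟩
    _ ≤ ∑ Y ∈ T with ∃ q ∈ blk p', q ∈ Y, ∑ q ∈ blk p' with q ∈ Y, g Y := by
        refine sum_le_sum fun Y hY => ?_
        obtain ⟨q, hqb, hqY⟩ := (mem_filter.1 hY).2
        have hmem : q ∈ (blk p').filter fun q => q ∈ Y := mem_filter.2 ⟨hqb, hqY⟩
        calc g Y = ∑ q' ∈ ({q} : Finset V), g Y := by simp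
          _ ≤ _ := sum_le_sum_of_subset_of_nonneg (by simpa using hmem) fun _ _ _ => hg0 _
    _ ≤ ∑ Y ∈ T, ∑ q ∈ blk p' with q ∈ Y, g Y := sum_le_sum_of_subset_of_nonneg (filter_subset _ _) fun _ _ _ => sum_nonneg fun _ _ => hg0 _
    _ = ∑ q ∈ blk p', ∑ Y ∈ T with q ∈ Y, g Y := by
        rw [sum_comm' (t' := blk p') (s' := fun q => T.filter fun Y => q ∈ Y)]
        intro Y q
        simp only [mem_filter]
        tauto

/-- **THE BLOCKED NORM FROM A UNIFORM CELL NORM**: in addition `#blk p' ≤ b` and `sup_q Σ_{Y∈T, q∈Y}‖K(Y)‖e^{τ#Y} ≤ η` ⟹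
`Σ_{Y'∈B(T), p'∈Y'}‖K'(Y')‖e^{τℓ(#Y'−m)} ≤ b·e^{−τ}·η`. [folklore] -/
theorem blockedNorm_le_of_uniform_largeSet (hτ : 0 ≤ τ) (B : V → W) (blk : W → Finset V) (hblk : ∀ q, q ∈ blk (B q)) (hb : ∀ p', (blk p').card ≤ b)
    (T : Finset (Finset V)) (hsep : ∀ Y ∈ T, ℓ * ((Y.image B).card - m) + 1 ≤ Y.card)
    (hN : ∀ q : V, ∑ Y ∈ T with q ∈ Y, ‖K Y‖ * Real.exp (τ * (Y.card : ℝ)) ≤ η) (hη0 : 0 ≤ η) (p' : W) :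
    ∑ Y' ∈ T.image (fun Y => Y.image B) with p' ∈ Y',
        ‖∑ Y ∈ T with Y.image B = Y', K Y‖ * Real.exp (τ * ((ℓ * (Y'.card - m) : ℕ) : ℝ)) ≤ b * (Real.exp (-τ) * η) := by
  refine (blockedNorm_le_cellNorm_largeSet hτ B blk hblk T hsep p').trans ?_
  -- each inner sum: shift the weight by one cell
  have hinner : ∀ q, ∑ Y ∈ T with q ∈ Y, ‖K Y‖ * Real.exp (τ * ((Y.card - 1 : ℕ) : ℝ)) ≤ Real.exp (-τ) * η := by
    intro q
    have hterm : ∀ Y ∈ T.filter (fun Y => q ∈ Y),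
        ‖K Y‖ * Real.exp (τ * ((Y.card - 1 : ℕ) : ℝ)) = Real.exp (-τ) * (‖K Y‖ * Real.exp (τ * (Y.card : ℝ))) := by
      intro Y hY
      have h1 : 1 ≤ Y.card := card_pos.2 ⟨q, (mem_filter.1 hY).2⟩
      have hc : (((Y.card - 1 : ℕ)) : ℝ) = (Y.card : ℝ) - 1 := by rw [Nat.cast_sub h1, Nat.cast_one]
      rw [hc, show τ * ((Y.card : ℝ) - 1) = -τ + τ * (Y.card : ℝ) by ring, Real.exp_add]
      ring
    rw [sum_congr rfl hterm, ← mul_sum]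
    exact mul_le_mul_of_nonneg_left (hN q) (exp_pos _).le
  calc ∑ q ∈ blk p', ∑ Y ∈ T with q ∈ Y, ‖K Y‖ * Real.exp (τ * ((Y.card - 1 : ℕ) : ℝ))
      ≤ ∑ _q ∈ blk p', Real.exp (-τ) * η := sum_le_sum fun q _ => hinner q
    _ = (blk p').card * (Real.exp (-τ) * η) := by rw [sum_const, nsmul_eq_mul]
    _ ≤ b * (Real.exp (-τ) * η) := mul_le_mul_of_nonneg_right (by exact_mod_cast hb p') (by positivity)

/-! ## §2. The large sets carry weight `τℓ∕(m+1)` per block -/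

/-- **THE LARGE BLOCK SUPPORTS HAVE WEIGHT `τℓ∕(m+1)` PER BLOCK**: under the hypotheses of `blockedNorm_le_of_uniform_largeSet`,
`Σ_{Y'∈B(T), p'∈Y', m+1 ≤ #Y'}‖K'(Y')‖e^{(τℓ∕(m+1))#Y'} ≤ b·e^{−τ}·η` (`#Y' ≥ m+1 ⟹ #Y'∕(m+1) ≤ #Y' − m`); the small sets `#Y' ≤ m` are not improved.
[folklore] -/
theorem largeSetNorm_le (hτ : 0 ≤ τ) (B : V → W) (blk : W → Finset V) (hblk : ∀ q, q ∈ blk (B q)) (hb : ∀ p', (blk p').card ≤ b)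
    (T : Finset (Finset V)) (hsep : ∀ Y ∈ T, ℓ * ((Y.image B).card - m) + 1 ≤ Y.card)
    (hN : ∀ q : V, ∑ Y ∈ T with q ∈ Y, ‖K Y‖ * Real.exp (τ * (Y.card : ℝ)) ≤ η) (hη0 : 0 ≤ η) (p' : W) :
    ∑ Y' ∈ T.image (fun Y => Y.image B) with p' ∈ Y' ∧ m + 1 ≤ Y'.card,
        ‖∑ Y ∈ T with Y.image B = Y', K Y‖ * Real.exp (τ * ℓ / (m + 1) * (Y'.card : ℝ)) ≤ b * (Real.exp (-τ) * η) := by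
  refine le_trans ?_ (blockedNorm_le_of_uniform_largeSet hτ B blk hblk hb T hsep hN hη0 p')
  calc ∑ Y' ∈ T.image (fun Y => Y.image B) with p' ∈ Y' ∧ m + 1 ≤ Y'.card,
        ‖∑ Y ∈ T with Y.image B = Y', K Y‖ * Real.exp (τ * ℓ / (m + 1) * (Y'.card : ℝ))
      ≤ ∑ Y' ∈ T.image (fun Y => Y.image B) with p' ∈ Y' ∧ m + 1 ≤ Y'.card,
        ‖∑ Y ∈ T with Y.image B = Y', K Y‖ * Real.exp (τ * ((ℓ * (Y'.card - m) : ℕ) : ℝ)) := by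
        refine sum_le_sum fun Y' hY' => mul_le_mul_of_nonneg_left (exp_le_exp.2 ?_) (norm_nonneg _)
        obtain ⟨-, -, h2⟩ := mem_filter.1 hY'
        have hcast : (((ℓ * (Y'.card - m) : ℕ)) : ℝ) = (ℓ : ℝ) * ((Y'.card : ℝ) - m) := by
          rw [Nat.cast_mul, Nat.cast_sub (by omega)]
        rw [hcast]
        have h2' : (m : ℝ) + 1 ≤ (Y'.card : ℝ) := by exact_mod_cast h2
        have hℓ : (0 : ℝ) ≤ ℓ := Nat.cast_nonneg ℓ
        have hm : (0 : ℝ) ≤ m := Nat.cast_nonneg m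
        have hm1 : (0 : ℝ) < (m : ℝ) + 1 := by linarith
        -- `#Y'/(m+1) ≤ #Y' − m`
        have hkey : (Y'.card : ℝ) / ((m : ℝ) + 1) ≤ (Y'.card : ℝ) - m := by
          rw [div_le_iff₀ hm1]
          nlinarith
        calc τ * ℓ / ((m : ℝ) + 1) * (Y'.card : ℝ) = τ * ℓ * ((Y'.card : ℝ) / ((m : ℝ) + 1)) := by ring
          _ ≤ τ * ℓ * ((Y'.card : ℝ) - m) := mul_le_mul_of_nonneg_left hkey (mul_nonneg hτ hℓ)
          _ = τ * ((ℓ : ℝ) * ((Y'.card : ℝ) - m)) := by ring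
    _ ≤ ∑ Y' ∈ T.image (fun Y => Y.image B) with p' ∈ Y',
        ‖∑ Y ∈ T with Y.image B = Y', K Y‖ * Real.exp (τ * ((ℓ * (Y'.card - m) : ℕ) : ℝ)) :=
        sum_le_sum_of_subset_of_nonneg (fun Y' hY' => mem_filter.2 ⟨(mem_filter.1 hY').1, (mem_filter.1 hY').2.1⟩) fun _ _ _ => by positivity

/-! ## §3. Toy -/

omit [DecidableEq V] in
/-- Toy (§1): with threshold `m = 0` and `ℓ = 1` the separation `#B(Y) + 1 ≤ #Y` would demand a non-injective block map on `Y`; with `ℓ = 0` it is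
`1 ≤ #Y`, i.e. nonemptiness, and the weight comparison is `e^0 ≤ e^{τ(#Y−1)}`. -/
example (hτ : 0 ≤ τ) (B : V → W) {Y : Finset V} (hY : 0 * ((Y.image B).card - 0) + 1 ≤ Y.card) :
    Real.exp (τ * ((0 * ((Y.image B).card - 0) : ℕ) : ℝ)) ≤ Real.exp (τ * (((Y.card - 1 : ℕ)) : ℝ)) :=
  exp_blockWeight_le_largeSet hτ B hY

end Summit.QuantumFields.BalabanUV.T4Continuum.NE7b.SupBlockingLargeSets
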